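import Summits.AnomalousDissipation.AnomalousDissipation.Theorems.MomentParityQuarticGateModeCalculus

/-!
# Sign averages of linear and quadratic functionals of a random-sign superposition

Helper file for stub S5 (`stub_balancedMenu`) of the line `farkas-split-menu` of crux
`MomentParity.CubicParityLoud` (stmt-AnomalousDissipation-11465). The atoms of the balanced menu
are the coefficient families `c(s) = m + ∑ᵢ ε(sᵢ) • Aᵢ` indexed by all sign patterns
`s : ι → Bool` (`ε(true) = 1`, `ε(false) = -1`) of a finite list of pieces `Aᵢ` around a mean
flow `m`. This file records the finite-average calculus of such superpositions:

* `sum_sign_mul_eq_zero` — `∑ₛ ε(sᵢ) G(s) = 0` whenever `G` is invariant under flipping the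
  `i`-th sign (the flip is an involution of the pattern space);
* `sum_sign_apply₁` — a real linear functional averages to its value at the mean:
  `∑ₛ L(c(s)) = 2^{#ι} L(m)`;
* `sum_sign_apply₂` — a real bilinear functional averages to the sum of its diagonal values:
  `∑ₛ β(c(s), c(s)) = 2^{#ι} (β(m, m) + ∑ᵢ β(Aᵢ, Aᵢ))` (all cross terms carry an odd sign);
* conjugate symmetry and transversality of such superpositions of coefficient families.
-/

namespace Summit.AnomalousDissipation.AnomalousDissipation.Theorems.MomentParityCubicParityLoud

open Finset
open Literature.Analysis.FunctionSpaces Literature.Analysis.FluidPDE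

set_option linter.dupNamespace false

section Signs

variable {ι : Type*} [Fintype ι] [DecidableEq ι]

/-- **Odd sign sums vanish**: if `G` is invariant under flipping the `i`-th sign then
`∑ₛ ε(sᵢ) G(s) = 0` (pair `s` with its flip). [folklore] -/
theorem sum_sign_mul_eq_zero (i : ι) (G : (ι → Bool) → ℝ)
    (hG : ∀ s, G (Function.update s i (!s i)) = G s) :
    ∑ s : ι → Bool, (if s i then (1 : ℝ) else -1) * G s = 0 := by
  set φ : (ι → Bool) → (ι → Bool) := fun s => Function.update s i (!s i) with hφ
  have hinv : Function.Involutive φ := fun s => by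
    simp only [hφ, Function.update_self, Bool.not_not, Function.update_idem, Function.update_eq_self]
  have hcomp := Equiv.sum_comp hinv.toPerm (fun s => (if s i then (1 : ℝ) else -1) * G s)
  have hneg : ∀ s, (if (φ s) i then (1 : ℝ) else -1) * G (φ s) =
      -((if s i then (1 : ℝ) else -1) * G s) := fun s => by
    simp only [hφ, Function.update_self, hG]
    cases s i <;> simp
  have h2 : ∑ s : ι → Bool, (if s i then (1 : ℝ) else -1) * G s =
      -∑ s : ι → Bool, (if s i then (1 : ℝ) else -1) * G s := by
    conv_lhs => rw [← hcomp]
    rw [← Finset.sum_neg_distrib]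
    exact Finset.sum_congr rfl fun s _ => hneg s
  linarith

/-- Mixed sign products average to zero: `∑ₛ ε(sᵢ) ε(sⱼ) = 0` for `i ≠ j`, with an arbitrary
weight invariant under the `i`-th flip. [folklore] -/
theorem sum_sign_mul_sign_mul_eq_zero {i j : ι} (hij : i ≠ j) (G : (ι → Bool) → ℝ)
    (hG : ∀ s, G (Function.update s i (!s i)) = G s) :
    ∑ s : ι → Bool, (if s i then (1 : ℝ) else -1) * ((if s j then (1 : ℝ) else -1) * G s) = 0 :=
  sum_sign_mul_eq_zero i _ fun s => by rw [Function.update_of_ne hij.symm, hG]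

omit [Fintype ι] [DecidableEq ι] in
/-- The square of a sign is one (product form). [folklore] -/
theorem sign_mul_sign_self (s : ι → Bool) (i : ι) :
    (if s i then (1 : ℝ) else -1) * (if s i then (1 : ℝ) else -1) = 1 := by
  cases s i <;> simp

end Signs

section Superposition

variable {ι : Type*} [Fintype ι] [DecidableEq ι] {F : Type*} [AddCommGroup F] [Module ℝ F]

/-- **A linear functional of the random-sign superposition averages to its value at the mean**:
`∑ₛ L(m + ∑ᵢ ε(sᵢ)Aᵢ) = #(ι → Bool) · L(m)`. [folklore] -/
theorem sum_sign_apply₁ (L : F →ₗ[ℝ] ℝ) (m : F) (A : ι → F) :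
    ∑ s : ι → Bool, L (m + ∑ i, (if s i then (1 : ℝ) else -1) • A i) =
      (Fintype.card (ι → Bool) : ℝ) * L m := by
  simp only [map_add, map_sum, map_smul, smul_eq_mul, Finset.sum_add_distrib, Finset.sum_const,
    Finset.card_univ, nsmul_eq_mul]
  rw [Finset.sum_comm, Finset.sum_eq_zero fun i _ => sum_sign_mul_eq_zero i _ fun _ => rfl, add_zero]

/-- **A bilinear functional of the random-sign superposition averages to the sum of its diagonal
values**: `∑ₛ β(c(s), c(s)) = #(ι → Bool) · (β(m, m) + ∑ᵢ β(Aᵢ, Aᵢ))` for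
`c(s) = m + ∑ᵢ ε(sᵢ)Aᵢ` — the terms `β(m, Aᵢ)`, `β(Aᵢ, m)` carry one sign and the terms
`β(Aᵢ, Aⱼ)`, `i ≠ j`, two independent signs, so they average out. [folklore] -/
theorem sum_sign_apply₂ (β : F →ₗ[ℝ] F →ₗ[ℝ] ℝ) (m : F) (A : ι → F) :
    ∑ s : ι → Bool, β (m + ∑ i, (if s i then (1 : ℝ) else -1) • A i)
        (m + ∑ i, (if s i then (1 : ℝ) else -1) • A i) =
      (Fintype.card (ι → Bool) : ℝ) * (β m m + ∑ i, β (A i) (A i)) := by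
  have hexp : ∀ s : ι → Bool, β (m + ∑ i, (if s i then (1 : ℝ) else -1) • A i)
      (m + ∑ i, (if s i then (1 : ℝ) else -1) • A i) =
      β m m + ∑ i, (if s i then (1 : ℝ) else -1) * β (A i) m +
        (∑ i, (if s i then (1 : ℝ) else -1) * β m (A i) +
        ∑ i, (if s i then (1 : ℝ) else -1) *
          ∑ j, (if s j then (1 : ℝ) else -1) * β (A j) (A i)) := by
    intro s
    simp only [map_add, map_sum, map_smul, LinearMap.add_apply, LinearMap.sum_apply,
      LinearMap.smul_apply, smul_eq_mul, mul_add, Finset.sum_add_distrib]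
  have h1 : ∑ s : ι → Bool, ∑ i, (if s i then (1 : ℝ) else -1) * β (A i) m = 0 := by
    rw [Finset.sum_comm]
    exact Finset.sum_eq_zero fun i _ => sum_sign_mul_eq_zero i _ fun _ => rfl
  have h2 : ∑ s : ι → Bool, ∑ i, (if s i then (1 : ℝ) else -1) * β m (A i) = 0 := by
    rw [Finset.sum_comm]
    exact Finset.sum_eq_zero fun i _ => sum_sign_mul_eq_zero i _ fun _ => rfl
  have h3 : ∑ s : ι → Bool, ∑ i, (if s i then (1 : ℝ) else -1) *
      ∑ j, (if s j then (1 : ℝ) else -1) * β (A j) (A i) =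
      (Fintype.card (ι → Bool) : ℝ) * ∑ i, β (A i) (A i) := by
    rw [Finset.sum_comm, Finset.mul_sum]
    refine Finset.sum_congr rfl fun i _ => ?_
    simp_rw [Finset.mul_sum]
    rw [Finset.sum_comm]
    rw [Fintype.sum_eq_single i fun j hj => sum_sign_mul_sign_mul_eq_zero (Ne.symm hj) _ fun _ => rfl]
    simp_rw [← mul_assoc, sign_mul_sign_self, one_mul]
    rw [Finset.sum_const, Finset.card_univ, nsmul_eq_mul]
  simp_rw [hexp]
  rw [Finset.sum_add_distrib, Finset.sum_add_distrib, Finset.sum_add_distrib, h1, h2, h3,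
    Finset.sum_const, Finset.card_univ, nsmul_eq_mul]
  ring

/-- Average form of `sum_sign_apply₁`: `(#(ι → Bool))⁻¹ ∑ₛ L(c(s)) = L(m)`. [folklore] -/
theorem average_sign_apply₁ (L : F →ₗ[ℝ] ℝ) (m : F) (A : ι → F) :
    (Fintype.card (ι → Bool) : ℝ)⁻¹ * ∑ s : ι → Bool, L (m + ∑ i, (if s i then (1 : ℝ) else -1) • A i) =
      L m := by
  rw [sum_sign_apply₁, ← mul_assoc, inv_mul_cancel₀ (by exact_mod_cast Fintype.card_ne_zero), one_mul]

/-- Average form of `sum_sign_apply₂`: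
`(#(ι → Bool))⁻¹ ∑ₛ β(c(s), c(s)) = β(m, m) + ∑ᵢ β(Aᵢ, Aᵢ)`. [folklore] -/
theorem average_sign_apply₂ (β : F →ₗ[ℝ] F →ₗ[ℝ] ℝ) (m : F) (A : ι → F) :
    (Fintype.card (ι → Bool) : ℝ)⁻¹ * ∑ s : ι → Bool, β (m + ∑ i, (if s i then (1 : ℝ) else -1) • A i)
        (m + ∑ i, (if s i then (1 : ℝ) else -1) • A i) =
      β m m + ∑ i, β (A i) (A i) := by
  rw [sum_sign_apply₂, ← mul_assoc, inv_mul_cancel₀ (by exact_mod_cast Fintype.card_ne_zero), one_mul]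

/-- Hypothesis form of `average_sign_apply₁` for a plain function `Φ : F → ℝ` that is additive and
real homogeneous. [folklore] -/
theorem average_sign_of_linear (Φ : F → ℝ) (hadd : ∀ x y, Φ (x + y) = Φ x + Φ y)
    (hsmul : ∀ (r : ℝ) x, Φ (r • x) = r * Φ x) (m : F) (A : ι → F) :
    (Fintype.card (ι → Bool) : ℝ)⁻¹ * ∑ s : ι → Bool, Φ (m + ∑ i, (if s i then (1 : ℝ) else -1) • A i) = Φ m :=
  average_sign_apply₁ { toFun := Φ, map_add' := hadd, map_smul' := hsmul } m A

/-- Hypothesis form of `average_sign_apply₂` for a plain function `Φ : F → F → ℝ` that is additive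
and real homogeneous in each argument. [folklore] -/
theorem average_sign_of_bilinear (Φ : F → F → ℝ) (hadd₁ : ∀ x y z, Φ (x + y) z = Φ x z + Φ y z)
    (hsmul₁ : ∀ (r : ℝ) x z, Φ (r • x) z = r * Φ x z) (hadd₂ : ∀ x y z, Φ x (y + z) = Φ x y + Φ x z)
    (hsmul₂ : ∀ (r : ℝ) x z, Φ x (r • z) = r * Φ x z) (m : F) (A : ι → F) :
    (Fintype.card (ι → Bool) : ℝ)⁻¹ * ∑ s : ι → Bool, Φ (m + ∑ i, (if s i then (1 : ℝ) else -1) • A i)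
        (m + ∑ i, (if s i then (1 : ℝ) else -1) • A i) = Φ m m + ∑ i, Φ (A i) (A i) :=
  average_sign_apply₂ (LinearMap.mk₂ ℝ Φ hadd₁ hsmul₁ hadd₂ hsmul₂) m A

end Superposition

/-! ## Conjugate symmetry and transversality of superpositions -/

section Families

variable {ι : Type*} (S : Finset (Fin 3 → ℤ))

/-- Transversality is preserved by sums. [folklore] -/
theorem isTransversal_add {c c' : (Fin 3 → ℤ) → EuclideanSpace ℂ (Fin 3)}
    (hc : Torus.IsTransversal S c) (hc' : Torus.IsTransversal S c') :
    Torus.IsTransversal S (c + c') := fun k hk => by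
  simp only [Pi.add_apply, PiLp.add_apply, mul_add, Finset.sum_add_distrib, hc k hk, hc' k hk, add_zero]

/-- Transversality is preserved by real scalar multiplication. [folklore] -/
theorem isTransversal_smul {c : (Fin 3 → ℤ) → EuclideanSpace ℂ (Fin 3)}
    (hc : Torus.IsTransversal S c) (a : ℝ) : Torus.IsTransversal S (a • c) := fun k hk => by
  have h := hc k hk
  simp only [Pi.smul_apply, PiLp.smul_apply, Complex.real_smul]
  calc ∑ j, (k j : ℂ) * ((a : ℂ) * c k j) = (a : ℂ) * ∑ j, (k j : ℂ) * c k j := by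
        rw [Finset.mul_sum]; exact Finset.sum_congr rfl fun j _ => by ring
    _ = 0 := by rw [h, mul_zero]

/-- The zero family is transversal. [folklore] -/
theorem isTransversal_zero : Torus.IsTransversal S (0 : (Fin 3 → ℤ) → EuclideanSpace ℂ (Fin 3)) :=
  fun k _ => by simp

/-- Transversality is preserved by finite sums. [folklore] -/
theorem isTransversal_sum (T : Finset ι) {A : ι → (Fin 3 → ℤ) → EuclideanSpace ℂ (Fin 3)}
    (hA : ∀ i ∈ T, Torus.IsTransversal S (A i)) : Torus.IsTransversal S (∑ i ∈ T, A i) := by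
  classical
  induction T using Finset.induction_on with
  | empty => rw [Finset.sum_empty]; exact isTransversal_zero S
  | insert i T hi ih =>
    rw [Finset.sum_insert hi]
    exact isTransversal_add S (hA i (Finset.mem_insert_self i T))
      (ih fun i' hi' => hA i' (Finset.mem_insert_of_mem hi'))

/-- Conjugate symmetry is preserved by finite sums. [folklore] -/
theorem isConjSymm_sum (T : Finset ι) {A : ι → (Fin 3 → ℤ) → EuclideanSpace ℂ (Fin 3)}
    (hA : ∀ i ∈ T, Torus.IsConjSymm (A i)) : Torus.IsConjSymm (∑ i ∈ T, A i) := by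
  classical
  induction T using Finset.induction_on with
  | empty => rw [Finset.sum_empty]; exact Torus.isConjSymm_zero
  | insert i T hi ih =>
    rw [Finset.sum_insert hi]
    exact (hA i (Finset.mem_insert_self i T)).add (ih fun i' hi' => hA i' (Finset.mem_insert_of_mem hi'))

variable [Fintype ι]

/-- **The random-sign superposition of conjugate-symmetric families is conjugate symmetric.**
[folklore] -/
theorem isConjSymm_superposition {m : (Fin 3 → ℤ) → EuclideanSpace ℂ (Fin 3)}
    {A : ι → (Fin 3 → ℤ) → EuclideanSpace ℂ (Fin 3)} (hm : Torus.IsConjSymm m)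
    (hA : ∀ i, Torus.IsConjSymm (A i)) (s : ι → Bool) :
    Torus.IsConjSymm (m + ∑ i, (if s i then (1 : ℝ) else -1) • A i) :=
  hm.add (isConjSymm_sum Finset.univ fun i _ => (hA i).real_smul _)

/-- **The random-sign superposition of transversal families is transversal.** [folklore] -/
theorem isTransversal_superposition {m : (Fin 3 → ℤ) → EuclideanSpace ℂ (Fin 3)}
    {A : ι → (Fin 3 → ℤ) → EuclideanSpace ℂ (Fin 3)} (hm : Torus.IsTransversal S m)
    (hA : ∀ i, Torus.IsTransversal S (A i)) (s : ι → Bool) :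
    Torus.IsTransversal S (m + ∑ i, (if s i then (1 : ℝ) else -1) • A i) :=
  isTransversal_add S hm (isTransversal_sum S Finset.univ fun i _ => isTransversal_smul S (hA i) _)

end Families

/-- **Registered sub-goal `balancedMenu_signAverage` of stub S5 `stub_balancedMenu`** (summary of this
file): a real bilinear functional of the random-sign superposition `m + ∑ᵢ ε(sᵢ) Aᵢ` averages over all
sign patterns to the sum of its diagonal values. [folklore] -/
theorem balancedMenu_signAverage : ∀ (ι : Type) [Fintype ι] [DecidableEq ι] (F : Type) [AddCommGroup F] [Module ℝ F] (β : F →ₗ[ℝ] F →ₗ[ℝ] ℝ) (m : F) (A : ι → F), (Fintype.card (ι → Bool) : ℝ)⁻¹ * ∑ s : ι → Bool, β (m + ∑ i, (if s i then (1 : ℝ) else -1) • A i) (m + ∑ i, (if s i then (1 : ℝ) else -1) • A i) = β m m + ∑ i, β (A i) (A i) :=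
  fun _ _ _ _ _ _ β m A => average_sign_apply₂ β m A

end Summit.AnomalousDissipation.AnomalousDissipation.Theorems.MomentParityCubicParityLoud
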